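import Literature.RepresentationTheory.HeisenbergGroup.SchrodingerPiIrreducible
import HarnessLib

/-!
# Irreducibility from the fibres over an anisotropic plane: the Heisenberg-parabolic (Kirillov) criterion on `𝒮(F^{ι₁ ⊔ ι₀})`

Topic `RepresentationTheory/HeisenbergGroup`; namespace `Literature.RepresentationTheory.HeisenbergGroup`.  KERNEL ONLY:
theorems, no definition, no named fact, no `sorry`.

An ABSTRACT irreducibility criterion for a subspace `E` of the Schwartz–Bruhat space `S = 𝒮(F^{ι₁ ⊔ ι₀})` of a
non-archimedean local field `F` (`ψ` continuous non-trivial, `ρ₀` the smooth Schrödinger model of the Heisenberg group of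
`F^{ι₀} ⊕ F^{ι₀}` on the FIBRES `𝒮(F^{ι₀})`, `u₀ ↦ f(θ, u₀)` over the points `θ ∈ F^{ι₁}`), acted on by a group `G`
through a representation `ω` on `S`.  It isolates what the mixed (Heisenberg-parabolic) model of a theta lift supplies:

* (Z)  for every `t ∈ F`, `ω(G)` contains, up to non-zero scalars, the multiplication by `ψ(t · Q(u₁))`, `Q` a continuous
  ANISOTROPIC function on `F^{ι₁}` (`Q x = 0 ↔ x = 0`) — the root group of the parabolic;
* (Lv) for all `θ, θ' ≠ 0`, some `ω(g)` maps the fibre over `θ'` onto the fibre over `θ` — the Levi torus;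
* (NP) over every `θ ≠ 0`, `ω(G)` induces on the fibre, up to scalars, ALL Heisenberg translations and modulations of
  `𝒮(F^{ι₀})` — the unipotent radical;
* (Circ) for `f ∈ E`, vanishing on one fibre `θ ≠ 0` propagates to the whole level set `Q = Q(θ)` — the compact centre;
* (SS) every `ω`-stable subspace of `E` has an `ω`-stable complement inside `E` — unitarity and admissibility.

THEN (`eq_bot_or_eq_of_fibreCriterion`) every `ω`-stable subspace `W ≤ E` is `⊥` or `E`.

Proof (no Jacquet functor, no Mackey theory — everything is read on point evaluations):
§1 fibres `u₀ ↦ f(θ, u₀)` are Schwartz–Bruhat and compatible with the Heisenberg operators in the `ι₀`-variables;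
a function vanishing on a fibre vanishes on a tube around it; a function vanishing off the plane `u₁ = 0` is `0`.
§2 CUT-OFFS ALONG `Q` (for any continuous `φ : F^ι → F`): a subspace stable under the multiplications by `ψ(t φ)`,
`t ∈ F`, is stable under the cut-offs `f ↦ 1_{φ ∈ a + 𝔭^k} f` — Fourier-free, by the elimination lemma of
`FiniteAdeleSchrodingerIrreducible` applied to the finitely many classes of `φ` modulo `𝔭^k` on the support (the
characters `t ↦ ψ(t a)` of `𝔭^{m-k}` separate the classes by the conductor); a function vanishing on a level set of `φ`
vanishes on a neighbouring shell (compactness).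
§3 the criterion: for `ω`-stable `W ≤ E`, either every `f ∈ W` vanishes off `u₁ = 0` (so `W = ⊥`), or — by (Lv) — EVERY
fibre image `W_θ`, `θ ≠ 0`, is non-zero, is Heisenberg-stable by (NP), hence ALL of `𝒮(F^{ι₀})` by the irreducibility of
the fibre model (`eq_top_of_invariant_pi`); then `W ⊇ K := {f ∈ E | f = 0 on the fibre over 0}`: for `k ∈ K` and each
`θ ≠ 0` pick `g_θ ∈ W` with the same fibre over `θ`; `k - g_θ ∈ E` vanishes on the level set `Q = Q(θ)` by (Circ), so
on a shell, so the `Q`-cut-offs of `k` near every value lie in `W`, and finitely many of them add up to `k`.  Finally if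
`W` and an `ω`-stable complement `W'` in `E` (SS) were both non-zero, both would contain `K`, so `K = 0`, so every
`f ∈ E` vanishes off `u₁ = 0` (its cut-offs away from `Q = 0` lie in `K`), so `E = 0`.

Written for the cell `hodgecm-mathlib` (fan B, rung B-IV), second proof route («Heisenberg-parabolic Kirillov model»)
to `MoeglinVignerasWaldspurger1987.mvw_IV4_rankOne_irreducibleOrZero` for ISOTROPIC hermitian spaces: there
`E` = the `χ`-isotypic subspace of the Weil representation in a Schrödinger model adapted to an isotropic line,
(Z)/(Lv)/(NP) come from the parabolic of the line, (Circ) from the compact `U(1)`, (SS) from unitarity + admissibility.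
Nothing about theta lifts is asserted here.

## References
* [MoeglinVignerasWaldspurger1987] C. Mœglin, M.-F. Vignéras, J.-L. Waldspurger, LNM 1291 (1987), Chap. 2 I.3–I.4,
  Chap. 3 §IV.2 (the mixed model `𝒮(Hom(X', W)) ⊗ S°` of the proof of the Lemme), §IV.4.
* [BernsteinZelevinsky1976] I. N. Bernstein, A. V. Zelevinsky, Russian Math. Surveys 31 (1976), §5 (restriction to the
  mirabolic / Kirillov model: the prototype of the argument).
* [WeilBNT1967] A. Weil, *Basic Number Theory* (1967), Ch. VII §2, Def. 1, Prop. 2 (standard functions on `F^ι`).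
-/

set_option autoImplicit false

noncomputable section

namespace Literature.RepresentationTheory.HeisenbergGroup

open Literature.NumberTheory.Automorphic
open Literature.NumberTheory.GaloisRepresentations.IsNonarchimedeanLocalField
open scoped Pointwise Classical

variable {F : Type*} [Field F] [ValuativeRel F] [TopologicalSpace F] [IsNonarchimedeanLocalField F]

/-! ## §1 Fibres of Schwartz–Bruhat functions on `F^{ι₁ ⊔ ι₀}` -/

section Fibres

variable {ι₁ ι₀ : Type*} [Fintype ι₁] [Fintype ι₀]

omit [Field F] [ValuativeRel F] [IsNonarchimedeanLocalField F] [Fintype ι₁] [Fintype ι₀] in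
/-- the fibre embedding `u₀ ↦ (θ, u₀)` is continuous. [folklore] -/
private theorem continuous_sumElim_right (θ : ι₁ → F) : Continuous fun u₀ : ι₀ → F => (Sum.elim θ u₀ : ι₁ ⊕ ι₀ → F) :=
  continuous_pi fun i => by
    rcases i with i | i
    · exact continuous_const
    · exact continuous_apply i

omit [Fintype ι₁] [Fintype ι₀] in
/-- **fibres of Schwartz–Bruhat functions are Schwartz–Bruhat**: `u₀ ↦ f(θ, u₀) ∈ 𝒮(F^{ι₀})`.
[cite: MoeglinVignerasWaldspurger1987, Chap. 2 I.4] -/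
theorem sumElim_mem_schwartzBruhat (θ : ι₁ → F) {f : (ι₁ ⊕ ι₀ → F) → ℂ} (hf : f ∈ SchwartzBruhat (ι₁ ⊕ ι₀ → F)) :
    (fun u₀ : ι₀ → F => f (Sum.elim θ u₀)) ∈ SchwartzBruhat (ι₀ → F) := by
  haveI : T2Space F := (isLocalField F).toT2Space
  rw [mem_schwartzBruhat_iff] at hf ⊢
  refine ⟨hf.1.comp_continuous (continuous_sumElim_right θ), ?_⟩
  refine HasCompactSupport.intro ((hf.2.isCompact).image (continuous_pi fun i => continuous_apply (Sum.inr i)))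
    fun u₀ hu₀ => ?_
  by_contra hne
  apply hu₀
  refine ⟨Sum.elim θ u₀, subset_tsupport _ (Function.mem_support.2 hne), ?_⟩
  funext i
  rfl

omit [Fintype ι₁] [Fintype ι₀] in
/-- **the fibre map** `f ↦ (u₀ ↦ f(θ, u₀))`, `𝒮(F^{ι₁ ⊔ ι₀}) →ₗ 𝒮(F^{ι₀})` (existence form, no new constant).
[cite: MoeglinVignerasWaldspurger1987, Chap. 2 I.4] -/
theorem exists_fibreMap (θ : ι₁ → F) :
    ∃ φ : SchwartzBruhat (ι₁ ⊕ ι₀ → F) →ₗ[ℂ] SchwartzBruhat (ι₀ → F),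
      ∀ (f : SchwartzBruhat (ι₁ ⊕ ι₀ → F)) (u₀ : ι₀ → F),
        (φ f : (ι₀ → F) → ℂ) u₀ = (f : (ι₁ ⊕ ι₀ → F) → ℂ) (Sum.elim θ u₀) :=
  ⟨{ toFun := fun f => ⟨fun u₀ => (f : (ι₁ ⊕ ι₀ → F) → ℂ) (Sum.elim θ u₀), sumElim_mem_schwartzBruhat θ f.2⟩
     map_add' := fun _ _ => Subtype.ext (funext fun _ => rfl)
     map_smul' := fun _ _ => Subtype.ext (funext fun _ => rfl) }, fun _ _ => rfl⟩

omit [ValuativeRel F] [TopologicalSpace F] [IsNonarchimedeanLocalField F] [Fintype ι₁] [Fintype ι₀] in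
/-- `(θ, u₀) + (x₁, x₀) = (θ + x₁, u₀ + x₀)`. [folklore] -/
private theorem sumElim_add_sumElim (θ x₁ : ι₁ → F) (u₀ x₀ : ι₀ → F) :
    (Sum.elim θ u₀ : ι₁ ⊕ ι₀ → F) + Sum.elim x₁ x₀ = Sum.elim (θ + x₁) (u₀ + x₀) := by
  funext i
  rcases i with i | i <;> rfl

omit [Field F] [ValuativeRel F] [TopologicalSpace F] [IsNonarchimedeanLocalField F] [Fintype ι₁] [Fintype ι₀] in
/-- `u = (u ∘ inl, u ∘ inr)`. [folklore] -/
private theorem sumElim_comp_inl_comp_inr (u : ι₁ ⊕ ι₀ → F) : Sum.elim (u ∘ Sum.inl) (u ∘ Sum.inr) = u :=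
  Sum.elim_comp_inl_inr u

/-- **a function vanishing on the fibre over `θ` vanishes on a tube around it** (uniform local constancy).
[cite: WeilBNT1967, Ch. VII §2, Prop. 2] -/
theorem exists_forall_eq_zero_of_fibre_eq_zero {f : (ι₁ ⊕ ι₀ → F) → ℂ} (hf : f ∈ SchwartzBruhat (ι₁ ⊕ ι₀ → F))
    (θ : ι₁ → F) (hθ : ∀ u₀ : ι₀ → F, f (Sum.elim θ u₀) = 0) :
    ∃ N : ℤ, ∀ u : ι₁ ⊕ ι₀ → F, u ∘ Sum.inl - θ ∈ piPrimePowBall F ι₁ N → f u = 0 := by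
  obtain ⟨N, hN⟩ := exists_forall_add_eq_of_mem_schwartzBruhat_pi hf
  refine ⟨N, fun u hu => ?_⟩
  have ht : (Sum.elim (u ∘ Sum.inl - θ) 0 : ι₁ ⊕ ι₀ → F) ∈ piPrimePowBall F (ι₁ ⊕ ι₀) N := by
    rw [mem_piPrimePowBall_iff]
    intro i
    rcases i with i | i
    · exact (mem_piPrimePowBall_iff.1 hu) i
    · exact zero_mem_primePowBall N
  have hu' : u = Sum.elim θ (u ∘ Sum.inr) + Sum.elim (u ∘ Sum.inl - θ) 0 := by
    rw [sumElim_add_sumElim, add_sub_cancel, add_zero, sumElim_comp_inl_comp_inr]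
  rw [hu', hN, hθ]
  exact ht

/-- **a Schwartz–Bruhat function vanishing off the plane `u₁ = 0` is zero** (`ι₁` non-empty: the plane has empty
interior). [cite: WeilBNT1967, Ch. VII §2, Prop. 2] -/
theorem eq_zero_of_forall_comp_inl_ne_zero [Nonempty ι₁] {f : (ι₁ ⊕ ι₀ → F) → ℂ}
    (hf : f ∈ SchwartzBruhat (ι₁ ⊕ ι₀ → F)) (h : ∀ u : ι₁ ⊕ ι₀ → F, u ∘ Sum.inl ≠ 0 → f u = 0) : f = 0 := by
  obtain ⟨N, hN⟩ := exists_forall_add_eq_of_mem_schwartzBruhat_pi hf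
  obtain ⟨a, ha0, ha⟩ := exists_normAbs_eq_inv_zpow_of_int (F := F) N
  funext u
  by_cases hu : u ∘ Sum.inl ≠ 0
  · exact h u hu
  · push Not at hu
    -- move off the plane inside the level box
    have ht : (Sum.elim (fun _ => a) 0 : ι₁ ⊕ ι₀ → F) ∈ piPrimePowBall F (ι₁ ⊕ ι₀) N := by
      rw [mem_piPrimePowBall_iff]
      intro i
      rcases i with i | i
      · exact le_of_eq ha
      · exact zero_mem_primePowBall N
    rw [← hN u _ ht, Pi.zero_apply]
    refine h _ fun h0 => ha0 ?_
    obtain ⟨i⟩ := (inferInstance : Nonempty ι₁)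
    have := congr_fun h0 i
    simp only [Function.comp_apply, Pi.add_apply, Sum.elim_inl, Pi.zero_apply] at this
    have hui : u (Sum.inl i) = 0 := by
      have := congr_fun hu i
      simpa only [Function.comp_apply, Pi.zero_apply] using this
    rwa [hui, zero_add] at this

end Fibres

/-! ## §2 Cut-offs along a continuous function `φ : F^ι → F` -/

section Cutoffs

variable {ι : Type*}

/-- the ball `𝔭^k` as an additive subgroup (carrier `primePowBall F k`). [folklore] -/
private theorem exists_addSubgroup_primePowBall (k : ℤ) :
    ∃ Λ : AddSubgroup F, (Λ : Set F) = primePowBall F k :=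
  ⟨{ carrier := primePowBall F k
     add_mem' := fun ha hb => add_mem_primePowBall ha hb
     zero_mem' := zero_mem_primePowBall k
     neg_mem' := fun ha => neg_mem_primePowBall ha }, rfl⟩

/-- `x - a ∈ 𝔭^k` and `x - a' ∈ 𝔭^k` force `a - a' ∈ 𝔭^k`. [folklore] -/
private theorem sub_mem_primePowBall_of_sub_mem {k : ℤ} {x a a' : F} (ha : x - a ∈ primePowBall F k)
    (ha' : x - a' ∈ primePowBall F k) : a - a' ∈ primePowBall F k := by
  have : a - a' = (x - a') - (x - a) := by ring
  rw [this, sub_eq_add_neg]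
  exact add_mem_primePowBall ha' (neg_mem_primePowBall ha)

/-- **finitely many classes modulo `𝔭^k` on the support**: for `f ∈ 𝒮(F^ι)` and a continuous `φ : F^ι → F` there is
a finite set `T ⊂ F` of `𝔭^k`-separated centres such that `φ(u)` is within `𝔭^k` of some centre wherever `f(u) ≠ 0`
(`u ↦ φ(u) mod 𝔭^k` is locally constant, the support is compact). [cite: WeilBNT1967, Ch. VII §2, Prop. 2] -/
theorem exists_finset_centres {φ : (ι → F) → F} (hφ : Continuous φ) {f : (ι → F) → ℂ}
    (hf : f ∈ SchwartzBruhat (ι → F)) (k : ℤ) :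
    ∃ T : Finset F, (∀ a ∈ T, ∀ a' ∈ T, a ≠ a' → a - a' ∉ primePowBall F k) ∧
      ∀ u, f u ≠ 0 → ∃ a ∈ T, φ u - a ∈ primePowBall F k := by
  classical
  obtain ⟨Λ, hΛ⟩ := exists_addSubgroup_primePowBall (F := F) k
  rw [mem_schwartzBruhat_iff] at hf
  -- the open cover of the support by the classes of `φ` modulo `𝔭^k`
  let O : F ⧸ Λ → Set (ι → F) := fun κ => {u | (QuotientAddGroup.mk (φ u) : F ⧸ Λ) = κ}
  have hO : ∀ κ, IsOpen (O κ) := by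
    intro κ
    rw [isOpen_iff_mem_nhds]
    intro u hu
    have hc : Continuous fun y => φ y - φ u := hφ.sub continuous_const
    have h1 : (fun y => φ y - φ u) ⁻¹' primePowBall F k ∈ nhds u := by
      apply hc.continuousAt.preimage_mem_nhds
      show primePowBall F k ∈ nhds (φ u - φ u)
      rw [sub_self]; exact primePowBall_mem_nhds_zero k
    refine Filter.mem_of_superset h1 fun y hy => ?_
    change (QuotientAddGroup.mk (φ y) : F ⧸ Λ) = κ
    rw [← show (QuotientAddGroup.mk (φ u) : F ⧸ Λ) = κ from hu]
    refine QuotientAddGroup.eq.2 ?_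
    rw [← SetLike.mem_coe, hΛ, neg_add_eq_sub]
    have : φ u - φ y = -(φ y - φ u) := by ring
    rw [this]
    exact neg_mem_primePowBall hy
  obtain ⟨Tκ, hTκ⟩ := hf.2.isCompact.elim_finite_subcover O hO fun u _ => Set.mem_iUnion.2 ⟨_, rfl⟩
  refine ⟨Tκ.image Quotient.out, ?_, ?_⟩
  · intro a ha a' ha' hne hmem
    obtain ⟨κ, -, rfl⟩ := Finset.mem_image.1 ha
    obtain ⟨κ', -, rfl⟩ := Finset.mem_image.1 ha'
    apply hne
    have hκ : (QuotientAddGroup.mk κ.out : F ⧸ Λ) = κ := QuotientAddGroup.out_eq' κ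
    have hκ' : (QuotientAddGroup.mk κ'.out : F ⧸ Λ) = κ' := QuotientAddGroup.out_eq' κ'
    have heq : κ' = κ := by
      rw [← hκ, ← hκ']
      refine QuotientAddGroup.eq.2 ?_
      rw [← SetLike.mem_coe, hΛ, neg_add_eq_sub]
      exact hmem
    rw [heq]
  · intro u hu
    have hu' : u ∈ tsupport f := subset_tsupport _ (Function.mem_support.2 hu)
    obtain ⟨κ, hκT, hκu⟩ := Set.mem_iUnion₂.1 (hTκ hu')
    refine ⟨κ.out, Finset.mem_image_of_mem _ hκT, ?_⟩
    have h1 : (QuotientAddGroup.mk (φ u) : F ⧸ Λ) = QuotientAddGroup.mk κ.out := by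
      rw [QuotientAddGroup.out_eq']; exact hκu
    have h2 := QuotientAddGroup.eq.1 h1.symm
    rw [← SetLike.mem_coe, hΛ, neg_add_eq_sub] at h2
    exact h2

/-- **pointwise decomposition along the classes**: with `T` as in `exists_finset_centres`,
`f(u) = Σ_{a ∈ T} 1_{φ(u) ∈ a + 𝔭^k} f(u)`. [cite: WeilBNT1967, Ch. VII §2, Prop. 2] -/
theorem eq_sum_ite_of_centres {φ : (ι → F) → F} {f : (ι → F) → ℂ} {k : ℤ} {T : Finset F}
    (hsep : ∀ a ∈ T, ∀ a' ∈ T, a ≠ a' → a - a' ∉ primePowBall F k)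
    (hcov : ∀ u, f u ≠ 0 → ∃ a ∈ T, φ u - a ∈ primePowBall F k) (u : ι → F) :
    f u = ∑ a ∈ T, (if φ u - a ∈ primePowBall F k then f u else 0) := by
  classical
  by_cases hu : f u = 0
  · rw [hu]
    exact (Finset.sum_eq_zero fun a _ => by split_ifs <;> rfl).symm
  · obtain ⟨a, haT, ha⟩ := hcov u hu
    rw [Finset.sum_eq_single_of_mem a haT]
    · rw [if_pos ha]
    · intro a' ha'T hne
      rw [if_neg]
      intro ha'
      exact hsep a' ha'T a haT hne (sub_mem_primePowBall_of_sub_mem ha' ha)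

/-- **the cut-off `1_{φ ∈ a + 𝔭^k} f` is Schwartz–Bruhat** (existence form). [cite: WeilBNT1967, Ch. VII §2, Def. 1] -/
theorem exists_cutoff {φ : (ι → F) → F} (hφ : Continuous φ) {f : (ι → F) → ℂ} (hf : f ∈ SchwartzBruhat (ι → F))
    (a : F) (k : ℤ) :
    ∃ f' : SchwartzBruhat (ι → F), ∀ u, (f' : (ι → F) → ℂ) u = if φ u - a ∈ primePowBall F k then f u else 0 := by
  classical
  haveI : T2Space F := (isLocalField F).toT2Space
  have hmem : (fun u => if φ u - a ∈ primePowBall F k then f u else 0) ∈ SchwartzBruhat (ι → F) := by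
    rw [mem_schwartzBruhat_iff] at hf ⊢
    have hset : IsClopen ((fun u => φ u - a) ⁻¹' primePowBall F k) :=
      ⟨(isCompact_primePowBall k).isClosed.preimage (hφ.sub continuous_const),
        (isOpen_primePowBall k).preimage (hφ.sub continuous_const)⟩
    refine ⟨?_, hf.2.mono fun u hu => ?_⟩
    · rw [IsLocallyConstant.iff_eventually_eq]
      intro x
      have hfx := hf.1.eventually_eq x
      by_cases hx : φ x - a ∈ primePowBall F k
      · have hS : ∀ᶠ y in nhds x, φ y - a ∈ primePowBall F k := hset.2.mem_nhds hx
        filter_upwards [hfx, hS] with y hy hyS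
        rw [if_pos hyS, if_pos hx, hy]
      · have hS : ∀ᶠ y in nhds x, φ y - a ∉ primePowBall F k := hset.1.isOpen_compl.mem_nhds hx
        filter_upwards [hS] with y hyS
        rw [if_neg hyS, if_neg hx]
    · by_contra h0
      apply hu
      simp only [Function.mem_support, ne_eq, not_not] at h0 ⊢
      rw [h0]; split_ifs <;> rfl
  exact ⟨⟨_, hmem⟩, fun u => rfl⟩

/-- **cut-off stability.**  If a subspace `W ≤ 𝒮(F^ι)` is stable under the multiplications by `ψ(t φ)` for all
`t ∈ F` (`ψ` continuous non-trivial, `φ` continuous), then it is stable under the cut-offs `f ↦ 1_{φ ∈ a + 𝔭^k} f`: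
on the support, `φ` takes finitely many values modulo `𝔭^k`, the multiplication by `ψ(t φ)`, `t ∈ 𝔭^{m-k}`
(`𝔭^m` the conductor), is `Σ_κ ψ(t a_κ) · (cut-off at κ)` with pairwise distinct characters of `𝔭^{m-k}`, and the
elimination lemma isolates each cut-off. [cite: MoeglinVignerasWaldspurger1987, Chap. 2 I.3] -/
theorem cutoff_mem_of_mul_mem {ψ : AddChar F Circle} (hψ : ψ.IsContinuousNontrivial) {φ : (ι → F) → F}
    (hφ : Continuous φ) (W : Submodule ℂ (SchwartzBruhat (ι → F)))
    (hW : ∀ (t : F) (f : SchwartzBruhat (ι → F)), f ∈ W → ∃ f' ∈ W,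
      ∀ u, (f' : (ι → F) → ℂ) u = (ψ (t * φ u) : ℂ) * (f : (ι → F) → ℂ) u)
    {f : SchwartzBruhat (ι → F)} (hf : f ∈ W) (a : F) (k : ℤ) (f' : SchwartzBruhat (ι → F))
    (hf' : ∀ u, (f' : (ι → F) → ℂ) u = if φ u - a ∈ primePowBall F k then (f : (ι → F) → ℂ) u else 0) :
    f' ∈ W := by
  classical
  obtain ⟨m, hm⟩ := hψ.exists_hasConductorExp
  obtain ⟨T, hsep, hcov⟩ := exists_finset_centres hφ f.2 k
  -- the cut-offs at the centres
  choose e he using fun a' : F => exists_cutoff hφ f.2 a' k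
  obtain ⟨Λ, hΛ⟩ := exists_addSubgroup_primePowBall (F := F) (m - k)
  have hmemΛ : ∀ t : Λ, (t : F) ∈ primePowBall F (m - k) := fun t => by rw [← hΛ]; exact t.2
  -- every cut-off at a centre lies in `W`
  have hterm : ∀ a' ∈ T, (1 : ℂ) • e a' ∈ W := by
    refine smul_mem_of_forall_sum_smul_mem W (fun (a' : F) (t : Λ) => (ψ ((t : F) * a') : ℂ)) ?_ ?_ e T
      (fun _ => (1 : ℂ)) ?_ ?_
    · intro a' t t'
      rw [AddSubgroup.coe_add, add_mul, AddChar.map_add_eq_mul, Circle.coe_mul]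
    · intro a'
      rw [AddSubgroup.coe_zero, zero_mul, AddChar.map_zero_eq_one, Circle.coe_one]
    · intro a' ha' a'' ha'' hne
      have h : a' - a'' ∉ primePowBall F (m - (m - k)) := by rw [sub_sub_cancel]; exact hsep a' ha' a'' ha'' hne
      obtain ⟨x₀, hx₀, hne'⟩ := exists_mem_primePowBall_addChar_mul_ne_one hm h
      refine ⟨⟨x₀, by rw [← SetLike.mem_coe, hΛ]; exact hx₀⟩, fun heq => hne' ?_⟩
      have heq' : (ψ (x₀ * a') : ℂ) = (ψ (x₀ * a'') : ℂ) := heq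
      have hq : ((ψ (x₀ * a') / ψ (x₀ * a'') : Circle) : ℂ) = 1 := by
        rw [Circle.coe_div, heq', div_self (Circle.coe_ne_zero _)]
      rw [mul_sub, AddChar.map_sub_eq_div]
      exact Circle.coe_inj.1 (by rw [Circle.coe_one]; exact hq)
    · intro t
      obtain ⟨ft, hftW, hft⟩ := hW (t : F) f hf
      have hcalc : ft = ∑ a' ∈ T, ((1 : ℂ) * (ψ ((t : F) * a') : ℂ)) • e a' := by
        apply Subtype.ext
        rw [AddSubmonoidClass.coe_finsetSum]
        funext u
        rw [hft u, Finset.sum_apply, eq_sum_ite_of_centres hsep hcov u, Finset.mul_sum]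
        refine Finset.sum_congr rfl fun a' _ => ?_
        rw [Submodule.coe_smul, Pi.smul_apply, smul_eq_mul, one_mul, he a' u]
        split_ifs with h
        · -- on the class of `a'` the phase is `ψ(t a')` (conductor)
          have hψ1 : ψ ((t : F) * (φ u - a')) = 1 := by
            refine hm.1 _ ?_
            have := mul_mem_primePowBall (hmemΛ t) h
            rwa [sub_add_cancel] at this
          have e1 : (t : F) * φ u = (t : F) * a' + (t : F) * (φ u - a') := by ring
          rw [e1, AddChar.map_add_eq_mul, hψ1, mul_one]
        · rw [mul_zero, mul_zero]
      rw [← hcalc]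
      exact hftW
  -- the target cut-off is one of them, or zero
  by_cases hex : ∃ a' ∈ T, a - a' ∈ primePowBall F k
  · obtain ⟨a', ha'T, haa'⟩ := hex
    have hfe : f' = e a' := by
      apply Subtype.ext
      funext u
      rw [hf' u, he a' u]
      by_cases h1 : φ u - a ∈ primePowBall F k
      · have h2 : φ u - a' ∈ primePowBall F k := by
          have : φ u - a' = (φ u - a) + (a - a') := by ring
          rw [this]; exact add_mem_primePowBall h1 haa'
        rw [if_pos h1, if_pos h2]
      · have h2 : φ u - a' ∉ primePowBall F k := by
          intro h2; apply h1
          have : φ u - a = (φ u - a') + -(a - a') := by ring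
          rw [this]; exact add_mem_primePowBall h2 (neg_mem_primePowBall haa')
        rw [if_neg h1, if_neg h2]
    have h := hterm a' ha'T
    rwa [one_smul, ← hfe] at h
  · push Not at hex
    have hf0 : f' = 0 := by
      apply Subtype.ext
      funext u
      rw [hf' u, ZeroMemClass.coe_zero, Pi.zero_apply]
      split_ifs with h1
      · by_contra hne
        obtain ⟨a', ha'T, ha'⟩ := hcov u hne
        exact hex a' ha'T (sub_mem_primePowBall_of_sub_mem h1 ha')
      · rfl
    rw [hf0]
    exact W.zero_mem

/-- **a function vanishing on a level set of `φ` vanishes on a shell around it** (`{f ≠ 0}` is compact and `φ - s₀`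
does not vanish there). [cite: WeilBNT1967, Ch. VII §2, Prop. 2] -/
theorem exists_forall_eq_zero_of_levelSet_eq_zero {φ : (ι → F) → F} (hφ : Continuous φ) {f : (ι → F) → ℂ}
    (hf : f ∈ SchwartzBruhat (ι → F)) (s₀ : F) (h : ∀ u, φ u = s₀ → f u = 0) :
    ∃ k : ℤ, ∀ u, φ u - s₀ ∈ primePowBall F k → f u = 0 := by
  haveI : T2Space F := (isLocalField F).toT2Space
  rw [mem_schwartzBruhat_iff] at hf
  -- the image of the support under `φ - s₀` is a compact set missing `0`
  set K : Set F := (fun u => φ u - s₀) '' tsupport f with hK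
  have hKc : IsCompact K := hf.2.isCompact.image (hφ.sub continuous_const)
  have h0 : (0 : F) ∉ K := by
    rintro ⟨u, hu, hu0⟩
    have hfu : f u = 0 := h u (sub_eq_zero.1 hu0)
    -- `tsupport f = support f` for a locally constant `f`
    have hsc : IsClosed (Function.support f) := by
      have h1 := hf.1.isOpen_fiber (0 : ℂ)
      rw [← isClosed_compl_iff] at h1
      convert h1 using 1
      ext x; simp [Function.mem_support]
    have hcl : tsupport f = Function.support f := hsc.closure_eq
    rw [hcl] at hu
    exact absurd hfu (Function.mem_support.1 hu)
  have hopen : Kᶜ ∈ nhds (0 : F) := hKc.isClosed.isOpen_compl.mem_nhds h0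
  obtain ⟨n, hn⟩ := exists_primePowBall_subset_of_mem_nhds_zero hopen
  refine ⟨n, fun u hu => ?_⟩
  by_contra hne
  exact hn hu ⟨u, subset_tsupport _ (Function.mem_support.2 hne), rfl⟩

end Cutoffs

/-! ## §3 The criterion -/

section Criterion

variable {ι₁ ι₀ : Type*} [Fintype ι₁] [Fintype ι₀] {ψ : AddChar F Circle}
  {G : Type*} [Group G] (ω : Representation ℂ G (SchwartzBruhat (ι₁ ⊕ ι₀ → F)))
  (E : Submodule ℂ (SchwartzBruhat (ι₁ ⊕ ι₀ → F))) {Q : (ι₁ → F) → F}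

omit [Field F] [ValuativeRel F] [IsNonarchimedeanLocalField F] [Fintype ι₁] [Fintype ι₀] in
/-- `u ↦ Q(u₁)` is continuous for `Q` continuous. [folklore] -/
private theorem continuous_comp_inl_of_continuous (hQc : Continuous Q) :
    Continuous fun u : ι₁ ⊕ ι₀ → F => Q (u ∘ Sum.inl) :=
  hQc.comp (continuous_pi fun i => continuous_apply (Sum.inl i))

omit [ValuativeRel F] [IsNonarchimedeanLocalField F] [Fintype ι₁] [Fintype ι₀] in
/-- (Z) read on an `ω`-stable subspace: it is stable under the multiplications by `ψ(t Q(u₁))`.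
[cite: MoeglinVignerasWaldspurger1987, Chap. 3 §IV.2] -/
theorem exists_mul_mem_of_root
    (hZ : ∀ (t : F) (f : SchwartzBruhat (ι₁ ⊕ ι₀ → F)), ∃ g : G, ∃ c : ℂ, c ≠ 0 ∧
      ∀ u, ((ω g f : SchwartzBruhat (ι₁ ⊕ ι₀ → F)) : (ι₁ ⊕ ι₀ → F) → ℂ) u =
        c * (ψ (t * Q (u ∘ Sum.inl)) : ℂ) * (f : (ι₁ ⊕ ι₀ → F) → ℂ) u)
    (W : Submodule ℂ (SchwartzBruhat (ι₁ ⊕ ι₀ → F))) (hW : ∀ g, W.map (ω g) ≤ W)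
    (t : F) (f : SchwartzBruhat (ι₁ ⊕ ι₀ → F)) (hf : f ∈ W) :
    ∃ f' ∈ W, ∀ u, (f' : (ι₁ ⊕ ι₀ → F) → ℂ) u =
      (ψ (t * (fun u : ι₁ ⊕ ι₀ → F => Q (u ∘ Sum.inl)) u) : ℂ) * (f : (ι₁ ⊕ ι₀ → F) → ℂ) u := by
  obtain ⟨g, c, hc, hg⟩ := hZ t f
  refine ⟨c⁻¹ • ω g f, W.smul_mem _ (hW g ⟨f, hf, rfl⟩), fun u => ?_⟩
  rw [Submodule.coe_smul, Pi.smul_apply, smul_eq_mul, hg u, ← mul_assoc, ← mul_assoc, inv_mul_cancel₀ hc, one_mul]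

/-- **Step B of the criterion**: if no non-zero vector of the `ω`-stable subspace `E` vanishes on the fibre over `0`,
then `E = ⊥` — the cut-offs of any `f ∈ E` away from the value `Q = 0` lie in `E` and vanish on that fibre, so `f`
is supported on the plane `u₁ = 0` (`Q` anisotropic), so `f = 0`. [cite: MoeglinVignerasWaldspurger1987, Chap. 3 §IV.2] -/
theorem eq_bot_of_forall_fibre_zero [Nonempty ι₁] (hψ : ψ.IsContinuousNontrivial) (hQc : Continuous Q) (hQ0 : ∀ x, Q x = 0 ↔ x = 0)
    (hE : ∀ g, E.map (ω g) ≤ E)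
    (hZ : ∀ (t : F) (f : SchwartzBruhat (ι₁ ⊕ ι₀ → F)), ∃ g : G, ∃ c : ℂ, c ≠ 0 ∧
      ∀ u, ((ω g f : SchwartzBruhat (ι₁ ⊕ ι₀ → F)) : (ι₁ ⊕ ι₀ → F) → ℂ) u =
        c * (ψ (t * Q (u ∘ Sum.inl)) : ℂ) * (f : (ι₁ ⊕ ι₀ → F) → ℂ) u)
    (hK : ∀ k ∈ E, (∀ u₀ : ι₀ → F, (k : (ι₁ ⊕ ι₀ → F) → ℂ) (Sum.elim 0 u₀) = 0) → k = 0) : E = ⊥ := by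
  classical
  have hφ := continuous_comp_inl_of_continuous (ι₀ := ι₀) hQc
  rw [eq_bot_iff]
  intro f hf
  rw [Submodule.mem_bot]
  apply Subtype.ext
  refine eq_zero_of_forall_comp_inl_ne_zero f.2 fun u hu => ?_
  -- cut `f` off near the value `a = Q(u₁) ≠ 0`
  have ha : Q (u ∘ Sum.inl) ≠ 0 := fun h => hu ((hQ0 _).1 h)
  obtain ⟨j, hj⟩ := exists_normAbs_eq_inv_zpow ha
  obtain ⟨f', hf'⟩ := exists_cutoff hφ f.2 (Q (u ∘ Sum.inl)) (j + 1)
  have hf'E : f' ∈ E := cutoff_mem_of_mul_mem hψ hφ E (exists_mul_mem_of_root ω hZ E hE) hf _ _ f' hf'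
  have hf'0 : ∀ u₀ : ι₀ → F, (f' : (ι₁ ⊕ ι₀ → F) → ℂ) (Sum.elim 0 u₀) = 0 := by
    intro u₀
    rw [hf' (Sum.elim 0 u₀), if_neg]
    have h0 : ((Sum.elim 0 u₀ : ι₁ ⊕ ι₀ → F) ∘ Sum.inl) = 0 := by funext i; rfl
    rw [h0, (hQ0 0).2 rfl, zero_sub, mem_primePowBall_iff, normAbs_neg, hj, not_le]
    exact zpow_lt_zpow_right_of_lt_one₀ inv_residueFieldCard_pos inv_residueFieldCard_lt_one (lt_add_one j)
  have h := hK f' hf'E hf'0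
  have hu' := hf' u
  rw [h, ZeroMemClass.coe_zero, Pi.zero_apply, sub_self, if_pos (zero_mem_primePowBall _)] at hu'
  exact hu'.symm

/-- **Step A of the criterion**: under (Z), (Lv), (NP), (Circ), a NON-ZERO `ω`-stable subspace `W ≤ E` contains every
vector of `E` vanishing on the fibre over `0`.  [By (Lv) every fibre image `W_θ` (`θ ≠ 0`) is non-zero, by (NP) it is
Heisenberg-stable, hence everything (`eq_top_of_invariant_pi`); a `k ∈ E` vanishing over `0` then agrees on each fibre
`θ ≠ 0` with some `g_θ ∈ W`, the difference vanishes on the level set `Q = Q(θ)` by (Circ), hence on a shell, so the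
`Q`-cut-offs of `k` lie in `W` and finitely many of them reassemble `k`.] [cite: MoeglinVignerasWaldspurger1987, Chap. 3 §IV.2] -/
theorem mem_of_fibre_zero_of_ne_bot [Nonempty ι₁] (hψ : ψ.IsContinuousNontrivial)
    (hl : IsLocallyConstant (⇑ψ : F → Circle)) (hb₀ : ∀ y : ι₀ → F, Continuous fun u : ι₀ → F => dotProductBilin F F u y)
    (hQc : Continuous Q)
    (hZ : ∀ (t : F) (f : SchwartzBruhat (ι₁ ⊕ ι₀ → F)), ∃ g : G, ∃ c : ℂ, c ≠ 0 ∧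
      ∀ u, ((ω g f : SchwartzBruhat (ι₁ ⊕ ι₀ → F)) : (ι₁ ⊕ ι₀ → F) → ℂ) u =
        c * (ψ (t * Q (u ∘ Sum.inl)) : ℂ) * (f : (ι₁ ⊕ ι₀ → F) → ℂ) u)
    (hLv : ∀ θ θ' : ι₁ → F, θ ≠ 0 → θ' ≠ 0 → ∃ g : G, ∃ c : ℂ, c ≠ 0 ∧
      ∀ (f : SchwartzBruhat (ι₁ ⊕ ι₀ → F)) (u₀ : ι₀ → F),
        ((ω g f : SchwartzBruhat (ι₁ ⊕ ι₀ → F)) : (ι₁ ⊕ ι₀ → F) → ℂ) (Sum.elim θ u₀) =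
          c * (f : (ι₁ ⊕ ι₀ → F) → ℂ) (Sum.elim θ' u₀))
    (hNP : ∀ θ : ι₁ → F, θ ≠ 0 → ∀ x₀ y₀ : ι₀ → F, ∃ g : G, ∃ c : ℂ, c ≠ 0 ∧
      ∀ (f : SchwartzBruhat (ι₁ ⊕ ι₀ → F)) (u₀ : ι₀ → F),
        ((ω g f : SchwartzBruhat (ι₁ ⊕ ι₀ → F)) : (ι₁ ⊕ ι₀ → F) → ℂ) (Sum.elim θ u₀) =
          c * (ψ (u₀ ⬝ᵥ y₀) : ℂ) * (f : (ι₁ ⊕ ι₀ → F) → ℂ) (Sum.elim θ (u₀ + x₀)))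
    (hCirc : ∀ f ∈ E, ∀ θ : ι₁ → F, θ ≠ 0 →
      (∀ u₀ : ι₀ → F, (f : (ι₁ ⊕ ι₀ → F) → ℂ) (Sum.elim θ u₀) = 0) →
        ∀ θ' : ι₁ → F, Q θ' = Q θ → ∀ u₀ : ι₀ → F, (f : (ι₁ ⊕ ι₀ → F) → ℂ) (Sum.elim θ' u₀) = 0)
    (W : Submodule ℂ (SchwartzBruhat (ι₁ ⊕ ι₀ → F))) (hWE : W ≤ E) (hW : ∀ g, W.map (ω g) ≤ W) (hW0 : W ≠ ⊥)
    (k : SchwartzBruhat (ι₁ ⊕ ι₀ → F)) (hkE : k ∈ E)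
    (hk0 : ∀ u₀ : ι₀ → F, (k : (ι₁ ⊕ ι₀ → F) → ℂ) (Sum.elim 0 u₀) = 0) : k ∈ W := by
  classical
  haveI : T2Space F := (isLocalField F).toT2Space
  have hφ := continuous_comp_inl_of_continuous (ι₀ := ι₀) hQc
  have hWmul := exists_mul_mem_of_root ω hZ W hW
  -- cut-offs (as Schwartz–Bruhat functions) and the cut-off stability of `W`
  choose cut hcut using fun (a : F) (kk : ℤ) (f : SchwartzBruhat (ι₁ ⊕ ι₀ → F)) => exists_cutoff hφ f.2 a kk
  have hWcut : ∀ f ∈ W, ∀ (a : F) (kk : ℤ), cut a kk f ∈ W :=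
    fun f hf a kk => cutoff_mem_of_mul_mem hψ hφ W hWmul hf a kk (cut a kk f) (hcut a kk f)
  -- fibre maps
  choose φ hφθ using fun θ : ι₁ → F => exists_fibreMap (F := F) (ι₀ := ι₀) θ
  /- Step A1: a vector of `W` not vanishing off the plane `u₁ = 0` -/
  obtain ⟨f₀, hf₀W, hf₀⟩ := (Submodule.ne_bot_iff W).1 hW0
  have hex : ∃ (θ₀ : ι₁ → F) (u₀ : ι₀ → F), θ₀ ≠ 0 ∧ (f₀ : (ι₁ ⊕ ι₀ → F) → ℂ) (Sum.elim θ₀ u₀) ≠ 0 := by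
    by_contra h
    push Not at h
    apply hf₀
    apply Subtype.ext
    refine eq_zero_of_forall_comp_inl_ne_zero f₀.2 fun u hu => ?_
    rw [← sumElim_comp_inl_comp_inr u]
    exact h _ _ hu
  obtain ⟨θ₀, u₀₀, hθ₀, hf₀θ₀⟩ := hex
  /- Step A2: every fibre image `W_θ`, `θ ≠ 0`, is all of `𝒮(F^{ι₀})` -/
  have htop : ∀ θ : ι₁ → F, θ ≠ 0 → W.map (φ θ) = ⊤ := by
    intro θ hθ
    refine eq_top_of_invariant_pi hl hb₀ hψ (W.map (φ θ)) ?_ ?_ ?_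
    · -- translations, from (NP) with `y₀ = 0`
      rintro x₀ _ ⟨f, hf, rfl⟩
      obtain ⟨g, c, hc, hg⟩ := hNP θ hθ x₀ 0
      refine ⟨c⁻¹ • ω g f, W.smul_mem _ (hW g ⟨f, hf, rfl⟩), Subtype.ext (funext fun u₀ => ?_)⟩
      rw [map_smul, Submodule.coe_smul, Pi.smul_apply, smul_eq_mul, hφθ, hg, schrodingerSB_piTransl_apply, hφθ,
        dotProduct_zero, AddChar.map_zero_eq_one, Circle.coe_one, mul_one, ← mul_assoc, inv_mul_cancel₀ hc, one_mul]
    · -- modulations, from (NP) with `x₀ = 0`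
      rintro y₀ _ ⟨f, hf, rfl⟩
      obtain ⟨g, c, hc, hg⟩ := hNP θ hθ 0 y₀
      refine ⟨c⁻¹ • ω g f, W.smul_mem _ (hW g ⟨f, hf, rfl⟩), Subtype.ext (funext fun u₀ => ?_)⟩
      rw [map_smul, Submodule.coe_smul, Pi.smul_apply, smul_eq_mul, hφθ, hg, schrodingerSB_piModul_apply, hφθ,
        add_zero, ← mul_assoc, ← mul_assoc, inv_mul_cancel₀ hc, one_mul]
    · -- non-zero, from (Lv)
      obtain ⟨g, c, hc, hg⟩ := hLv θ θ₀ hθ hθ₀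
      intro hbot
      have hmem : φ θ (ω g f₀) ∈ W.map (φ θ) := ⟨ω g f₀, hW g ⟨f₀, hf₀W, rfl⟩, rfl⟩
      rw [hbot, Submodule.mem_bot] at hmem
      have h := congr_arg (fun w : SchwartzBruhat (ι₀ → F) => (w : (ι₀ → F) → ℂ) u₀₀) hmem
      simp only [hφθ, hg, ZeroMemClass.coe_zero, Pi.zero_apply, mul_eq_zero] at h
      exact h.elim hc hf₀θ₀
  /- Step A3: the cut-offs of `k` near every value lie in `W` -/
  have hval : ∀ s : F, ∃ kk : ℤ, cut s kk k ∈ W := by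
    intro s
    by_cases hs : ∃ u, (k : (ι₁ ⊕ ι₀ → F) → ℂ) u ≠ 0 ∧ Q (u ∘ Sum.inl) = s
    · obtain ⟨u, hku, hus⟩ := hs
      set θ : ι₁ → F := u ∘ Sum.inl with hθdef
      have hθ : θ ≠ 0 := by
        intro h0
        apply hku
        rw [← sumElim_comp_inl_comp_inr u, ← hθdef, h0]
        exact hk0 _
      -- `g ∈ W` with the same fibre over `θ`
      have hmem : φ θ k ∈ W.map (φ θ) := by rw [htop θ hθ]; exact Submodule.mem_top
      obtain ⟨g, hgW, hgk⟩ := hmem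
      -- `k - g ∈ E` vanishes on the fibre over `θ`, hence on the level set `Q = s`, hence on a shell
      have hdE : k - g ∈ E := E.sub_mem hkE (hWE hgW)
      have hdθ : ∀ u₀ : ι₀ → F, ((k - g : SchwartzBruhat (ι₁ ⊕ ι₀ → F)) : (ι₁ ⊕ ι₀ → F) → ℂ) (Sum.elim θ u₀) = 0 := by
        intro u₀
        have h := congr_arg (fun w : SchwartzBruhat (ι₀ → F) => (w : (ι₀ → F) → ℂ) u₀) hgk
        simp only [hφθ] at h
        rw [Submodule.coe_sub, Pi.sub_apply, h, sub_self]
      have hlev : ∀ u', Q (u' ∘ Sum.inl) = s →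
          ((k - g : SchwartzBruhat (ι₁ ⊕ ι₀ → F)) : (ι₁ ⊕ ι₀ → F) → ℂ) u' = 0 := by
        intro u' hu'
        rw [← sumElim_comp_inl_comp_inr u']
        exact hCirc _ hdE θ hθ hdθ (u' ∘ Sum.inl) (by rw [hu', ← hus]) _
      obtain ⟨kk, hkk⟩ := exists_forall_eq_zero_of_levelSet_eq_zero hφ (k - g).2 s hlev
      refine ⟨kk, ?_⟩
      -- the cut-off of `k` at `(s, kk)` is the cut-off of `g`
      have heq : cut s kk k = cut s kk g := by
        apply Subtype.ext
        funext u'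
        rw [hcut, hcut]
        split_ifs with h1
        · have h := hkk u' h1
          rw [Submodule.coe_sub, Pi.sub_apply] at h
          exact sub_eq_zero.1 h
        · rfl
      rw [heq]
      exact hWcut g hgW s kk
    · -- `k` vanishes on the level set `Q = s`
      push Not at hs
      have hlev : ∀ u', Q (u' ∘ Sum.inl) = s → (k : (ι₁ ⊕ ι₀ → F) → ℂ) u' = 0 := by
        intro u' hu'
        by_contra hne
        exact hs u' hne hu'
      obtain ⟨kk, hkk⟩ := exists_forall_eq_zero_of_levelSet_eq_zero hφ k.2 s hlev
      refine ⟨kk, ?_⟩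
      have h0 : cut s kk k = 0 := by
        apply Subtype.ext
        funext u'
        rw [hcut, ZeroMemClass.coe_zero, Pi.zero_apply]
        split_ifs with h1
        · exact hkk u' h1
        · rfl
      rw [h0]
      exact W.zero_mem
  /- Step A4: patch finitely many cut-offs together -/
  choose kk hkk using hval
  -- a finite subcover of the support by the shells `{Q(u₁) ∈ s + 𝔭^{kk s}}`
  have hkmem : (k : (ι₁ ⊕ ι₀ → F) → ℂ) ∈ SchwartzBruhat (ι₁ ⊕ ι₀ → F) := k.2
  rw [mem_schwartzBruhat_iff] at hkmem
  let O : F → Set (ι₁ ⊕ ι₀ → F) := fun s => (fun u => Q (u ∘ Sum.inl) - s) ⁻¹' primePowBall F (kk s)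
  have hO : ∀ s, IsOpen (O s) := fun s => (isOpen_primePowBall (kk s)).preimage (hφ.sub continuous_const)
  obtain ⟨Sf, hSf⟩ := hkmem.2.isCompact.elim_finite_subcover O hO fun u _ =>
    Set.mem_iUnion.2 ⟨Q (u ∘ Sum.inl), by
      change Q (u ∘ Sum.inl) - Q (u ∘ Sum.inl) ∈ primePowBall F (kk (Q (u ∘ Sum.inl)))
      rw [sub_self]; exact zero_mem_primePowBall _⟩
  -- a common finer level
  set kmax : ℤ := ((Sf.sup fun s => (kk s).toNat : ℕ) : ℤ) with hkmax
  have hkmax_ge : ∀ s ∈ Sf, kk s ≤ kmax := fun s hs =>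
    (Int.self_le_toNat (kk s)).trans (by
      rw [hkmax]; exact_mod_cast Finset.le_sup (f := fun s => (kk s).toNat) hs)
  -- every cut-off of `k` at level `kmax` lies in `W`
  have hcutW : ∀ a : F, cut a kmax k ∈ W := by
    intro a
    by_cases hex : ∃ u, (k : (ι₁ ⊕ ι₀ → F) → ℂ) u ≠ 0 ∧ Q (u ∘ Sum.inl) - a ∈ primePowBall F kmax
    · obtain ⟨u, hku, hua⟩ := hex
      obtain ⟨s, hsS, hus⟩ := Set.mem_iUnion₂.1 (hSf (subset_tsupport _ (Function.mem_support.2 hku)))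
      change Q (u ∘ Sum.inl) - s ∈ primePowBall F (kk s) at hus
      -- the ball `a + 𝔭^kmax` lies in the shell `s + 𝔭^{kk s}`
      have hball : ∀ x : F, x - a ∈ primePowBall F kmax → x - s ∈ primePowBall F (kk s) := by
        intro x hx
        have e : x - s = (x - a) + -(Q (u ∘ Sum.inl) - a) + (Q (u ∘ Sum.inl) - s) := by ring
        rw [e]
        exact add_mem_primePowBall (add_mem_primePowBall (primePowBall_antitone (hkmax_ge s hsS) hx)
          (neg_mem_primePowBall (primePowBall_antitone (hkmax_ge s hsS) hua))) hus
      have heq : cut a kmax k = cut a kmax (cut s (kk s) k) := by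
        apply Subtype.ext
        funext u'
        rw [hcut, hcut, hcut]
        split_ifs with h1 h2
        · rfl
        · exact absurd (hball _ h1) h2
        · rfl
      rw [heq]
      exact hWcut _ (hkk s) a kmax
    · push Not at hex
      have h0 : cut a kmax k = 0 := by
        apply Subtype.ext
        funext u'
        rw [hcut, ZeroMemClass.coe_zero, Pi.zero_apply]
        split_ifs with h1
        · by_contra hne
          exact hex u' hne h1
        · rfl
      rw [h0]
      exact W.zero_mem
  -- `k` is the sum of its cut-offs at the centres of level `kmax`
  obtain ⟨T, hsep, hcov⟩ := exists_finset_centres hφ k.2 kmax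
  have hksum : k = ∑ a ∈ T, cut a kmax k := by
    apply Subtype.ext
    rw [AddSubmonoidClass.coe_finsetSum]
    funext u'
    rw [Finset.sum_apply, eq_sum_ite_of_centres hsep hcov u']
    exact Finset.sum_congr rfl fun a _ => (hcut a kmax k u').symm
  rw [hksum]
  exact W.sum_mem fun a _ => hcutW a

/-- **THE FIBRE CRITERION.**  Let `E ≤ 𝒮(F^{ι₁ ⊔ ι₀})` be `ω`-stable.  Assume (Z) the root group: `ω(G)` contains,
up to non-zero scalars, every multiplication by `ψ(t · Q(u₁))` with `Q` continuous and anisotropic; (Lv) the Levi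
torus: `ω(G)` moves the fibre over `θ'` onto the fibre over `θ` for all `θ, θ' ≠ 0`; (NP) the unipotent radical: over
each `θ ≠ 0`, `ω(G)` induces up to scalars all Heisenberg operators of `𝒮(F^{ι₀})`; (Circ) the compact centre: for
`f ∈ E`, vanishing on one fibre `θ ≠ 0` propagates to the level set `Q = Q(θ)`; (SS) complete reducibility inside `E`.
Then EVERY `ω`-STABLE SUBSPACE OF `E` IS `⊥` OR `E`. [cite: MoeglinVignerasWaldspurger1987, Chap. 3 §IV.4 Théorème principal 1) a)] -/
theorem eq_bot_or_eq_of_fibreCriterion [Nonempty ι₁] (hψ : ψ.IsContinuousNontrivial)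
    (hl : IsLocallyConstant (⇑ψ : F → Circle)) (hb₀ : ∀ y : ι₀ → F, Continuous fun u : ι₀ → F => dotProductBilin F F u y)
    (hQc : Continuous Q) (hQ0 : ∀ x, Q x = 0 ↔ x = 0)
    (hE : ∀ g, E.map (ω g) ≤ E)
    (hZ : ∀ (t : F) (f : SchwartzBruhat (ι₁ ⊕ ι₀ → F)), ∃ g : G, ∃ c : ℂ, c ≠ 0 ∧
      ∀ u, ((ω g f : SchwartzBruhat (ι₁ ⊕ ι₀ → F)) : (ι₁ ⊕ ι₀ → F) → ℂ) u =
        c * (ψ (t * Q (u ∘ Sum.inl)) : ℂ) * (f : (ι₁ ⊕ ι₀ → F) → ℂ) u)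
    (hLv : ∀ θ θ' : ι₁ → F, θ ≠ 0 → θ' ≠ 0 → ∃ g : G, ∃ c : ℂ, c ≠ 0 ∧
      ∀ (f : SchwartzBruhat (ι₁ ⊕ ι₀ → F)) (u₀ : ι₀ → F),
        ((ω g f : SchwartzBruhat (ι₁ ⊕ ι₀ → F)) : (ι₁ ⊕ ι₀ → F) → ℂ) (Sum.elim θ u₀) =
          c * (f : (ι₁ ⊕ ι₀ → F) → ℂ) (Sum.elim θ' u₀))
    (hNP : ∀ θ : ι₁ → F, θ ≠ 0 → ∀ x₀ y₀ : ι₀ → F, ∃ g : G, ∃ c : ℂ, c ≠ 0 ∧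
      ∀ (f : SchwartzBruhat (ι₁ ⊕ ι₀ → F)) (u₀ : ι₀ → F),
        ((ω g f : SchwartzBruhat (ι₁ ⊕ ι₀ → F)) : (ι₁ ⊕ ι₀ → F) → ℂ) (Sum.elim θ u₀) =
          c * (ψ (u₀ ⬝ᵥ y₀) : ℂ) * (f : (ι₁ ⊕ ι₀ → F) → ℂ) (Sum.elim θ (u₀ + x₀)))
    (hCirc : ∀ f ∈ E, ∀ θ : ι₁ → F, θ ≠ 0 →
      (∀ u₀ : ι₀ → F, (f : (ι₁ ⊕ ι₀ → F) → ℂ) (Sum.elim θ u₀) = 0) →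
        ∀ θ' : ι₁ → F, Q θ' = Q θ → ∀ u₀ : ι₀ → F, (f : (ι₁ ⊕ ι₀ → F) → ℂ) (Sum.elim θ' u₀) = 0)
    (hSS : ∀ W : Submodule ℂ (SchwartzBruhat (ι₁ ⊕ ι₀ → F)), W ≤ E → (∀ g, W.map (ω g) ≤ W) →
      ∃ W' : Submodule ℂ (SchwartzBruhat (ι₁ ⊕ ι₀ → F)), W' ≤ E ∧ (∀ g, W'.map (ω g) ≤ W') ∧
        W ⊓ W' = ⊥ ∧ W ⊔ W' = E)
    (W : Submodule ℂ (SchwartzBruhat (ι₁ ⊕ ι₀ → F))) (hWE : W ≤ E) (hW : ∀ g, W.map (ω g) ≤ W) :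
    W = ⊥ ∨ W = E := by
  by_cases hW0 : W = ⊥
  · exact Or.inl hW0
  right
  obtain ⟨W', hW'E, hW', hinf, hsup⟩ := hSS W hWE hW
  by_cases hW'0 : W' = ⊥
  · rw [hW'0, sup_bot_eq] at hsup
    exact hsup
  -- both `W` and `W'` contain the vectors of `E` vanishing over `0`, so there are none, so `E = ⊥`
  have hK : ∀ k ∈ E, (∀ u₀ : ι₀ → F, (k : (ι₁ ⊕ ι₀ → F) → ℂ) (Sum.elim 0 u₀) = 0) → k = 0 := by
    intro k hkE hk0
    have h1 := mem_of_fibre_zero_of_ne_bot ω E hψ hl hb₀ hQc hZ hLv hNP hCirc W hWE hW hW0 k hkE hk0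
    have h2 := mem_of_fibre_zero_of_ne_bot ω E hψ hl hb₀ hQc hZ hLv hNP hCirc W' hW'E hW' hW'0 k hkE hk0
    have h : k ∈ W ⊓ W' := ⟨h1, h2⟩
    rwa [hinf, Submodule.mem_bot] at h
  have hEbot : E = ⊥ := eq_bot_of_forall_fibre_zero ω E hψ hQc hQ0 hE hZ hK
  exact absurd (le_bot_iff.1 (hEbot ▸ hWE)) hW0

end Criterion

end Literature.RepresentationTheory.HeisenbergGroup

end
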